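import Summits.BirchSwinnertonDyer.BirchSwinnertonDyer.Theorems.KatoDescentPotSupersingularKatoFiniteLevelStrictSurj
import Summits.BirchSwinnertonDyer.BirchSwinnertonDyer.Theorems.KatoDescentPotSupersingularPrimaryDivisibleCore
import Summits.BirchSwinnertonDyer.Rank1Residual.X11b.UnramifiedPrimaryVanishing
import HarnessLib

/-!
# Kato's (14.9.3) at finite level, part 5: the local bound (hN) DISCHARGED — at the good places by the divisibility of
# `E[p^∞]`, at the finitely many bad places `v ∉ P` by the divisible-core TOOL — so that the exact count
# `#H¹(O_K[1/p], E[p^{m+e}]) = #Sel_str^{ur}(K, E[p^∞]) · ∏_{v∣p} #𝓚_v` holds for ALL `e ≥ e₁(W, p, T)`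
# (route `KatoDescentPotSupersingular` / `…Tame…`, crux M = stmt-BirchSwinnertonDyer-19196; route-free helper)

Seat `bsd-potss-rkm` g17 (prover; cell `bsd-potss`), item stmt-BirchSwinnertonDyer-19196 `ReducibleKatoMember`
(`--supports … --as helper`; closes nothing).  HONEST FRAMING: BSD is not proved by any of this; nothing is booked;
theorems only (no definition, no named fact).  Sequel of `…KatoFiniteLevelStrictSurj`.

## What

* `exists_nsmul_fixed_of_good` — at a finite place `v ∤ p` of good reduction the inertia group of `K_v` acts trivially on
  `E[p^∞]` (X11b `smul_geomPrimaryTorsion_eq_of_mem_absInertia`) and `E[p^∞]` is divisible (`E(K̄)` divisible), so the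
  bound (hN) of part 4 holds there for every `m`, `e`.
* `exists_bound_inertiaInvariants` — at ANY finite place `v`, the `I_v`-fixed points `N_v ⊆ E[p^∞]` form a `p`-primary torsion
  subgroup with finite layers, so by `DivisibleCore.exists_pow_nsmul_eq_pow_add_nsmul` there is `e_v` with `p^{e_v} N_v`
  `p`-divisible in `N_v`; hence (hN) at `v` for every `e ≥ e_v` and every `m`.
* **`exists_forall_hN`** — for finite sets `P ⊆ T` of finite places with `T ⊇` the bad places and the places above `p`
  (hypothesis `hT : v ∉ T → p ∉ v ∧ good reduction at v`), there is `e₁` such that (hN) holds at EVERY finite `v ∉ P` for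
  every `e ≥ e₁` and every `m` (`e₁ = max_{v ∈ T∖P} e_v`).
* **`exists_forall_natCard_selmerGroup_relaxed_eq`** — consequently there is `e₁` such that for every `e ≥ e₁`, every `m`
  with `p^m · Sel_str^{ur}(K,E[p^∞]) = 0` and `p^e · E(K_v)[p^∞] = 0` (`v ∈ P`), every Poitou–Tate family at level `p^{m+e}`
  and Kato's structures `𝓢 ≤ ℛ` at that level: `#H¹_ℛ(K,E[p^{m+e}]) = #Sel_str^{ur}(K,E[p^∞]) · ∏_{v∈P} #𝓚_v`.
  The remaining hypotheses are finiteness of `Sel_str^{ur}` (rank-0 input), the exponent `m`, the local torsion bound at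
  `P` (finite local torsion), and `SelmerComplement` of the family — all theorem-shaped.

References: K. Kato, Astérisque 295 (2004) (14.9.3)–(14.9.4), Prop. 14.16 [Kato2004Asterisque]; R. Greenberg, LNM 1716
(1999) §3 Lemma 3.3 [GreenbergLNM1716]; J. H. Silverman, *AEC* VII.4.1, VIII §2 [SilvermanAEC2009].
-/

-- the summit and its single problem are both named `BirchSwinnertonDyer` (registry layout D-0017)
set_option linter.dupNamespace false
set_option autoImplicit false

noncomputable section

open scoped Classical ContRepresentation NumberField
open Function Field NumberField IsDedekindDomain WeierstrassCurve
open Literature.NumberTheory.EllipticCurves Literature.NumberTheory.GaloisRepresentations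
  Literature.NumberTheory.GaloisRepresentations.DiscreteGaloisModule Literature.NumberTheory.GaloisCohomology
open Summit.BirchSwinnertonDyer.Rank1Residual.X11b.Levels Summit.BirchSwinnertonDyer.Rank1Residual.X11b.LocBridge
open Summit.BirchSwinnertonDyer.Rank1Residual.GaloisImage

universe u

namespace Summit.BirchSwinnertonDyer.BirchSwinnertonDyer.Theorems.KatoFiniteLevelCount

section Bounds

-- `K : Type`: the X11b inertia lemmas at good places (`UnramifiedPrimaryVanishing`) are stated in universe `0`.
variable {K : Type} [Field K] [NumberField K] (W : WeierstrassCurve K) [W.IsElliptic] (p : ℕ) [Fact p.Prime]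

/-- **(hN) at a good place `v ∤ p`, for every `m`, `e`**: inertia acts trivially on `E[p^∞]` there (X11b `restrictField_primaryGaloisModule_apply_of_mem_absInertia`) and `E[p^∞]`
is divisible, so for every `x` a `p^m`-th root `d` of `x` gives `p^{m+e} d = p^e x`. [cite: SilvermanAEC2009, Prop. VII.4.1(a) and §VIII.2] -/
theorem exists_nsmul_fixed_of_good {v : HeightOneSpectrum (𝓞 K)} (hpv : (p : 𝓞 K) ∉ v.asIdeal)
    (hv : W.HasGoodReductionAt v) (m e : ℕ) (x : W.geomPrimaryTorsion p) :
    ∃ d : W.geomPrimaryTorsion p,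
      (∀ τ ∈ absInertia (v.adicCompletion K), GaloisRep.toLocal v (primaryGaloisModule W p) τ d = d) ∧
        p ^ (m + e) • d = p ^ e • x := by
  have hdiv : W.zsmul_geomPoints_surjective := W.zsmul_geomPoints_surjective_holds
  obtain ⟨d, hd⟩ := exists_pow_nsmul_eq_geomPrimaryTorsion W p m hdiv x
  refine ⟨d, ?_, ?_⟩
  · intro τ hτ
    have h := restrictField_primaryGaloisModule_apply_of_mem_absInertia W p hpv hv hτ d
    exact h
  · rw [pow_add, mul_comm, mul_smul, hd]

/-- **(hN) at ANY finite place, for `e` large**: the `I_v`-fixed points of `E[p^∞]` form a `p`-primary torsion subgroup with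
finite layers, so some `p^{e_v}`-multiple of it is `p`-divisible (`DivisibleCore.exists_pow_nsmul_eq_pow_add_nsmul`); for
`e ≥ e_v` and every `m`, every `I_v`-fixed `x` has an `I_v`-fixed `d` with `p^{m+e} d = p^e x`.
[cite: GreenbergLNM1716, §3 proof of Lemma 3.3 (p. 87)] -/
theorem exists_bound_inertiaInvariants (v : HeightOneSpectrum (𝓞 K)) :
    ∃ e₀ : ℕ, ∀ e, e₀ ≤ e → ∀ (m : ℕ) (x : W.geomPrimaryTorsion p),
      (∀ τ ∈ absInertia (v.adicCompletion K), GaloisRep.toLocal v (primaryGaloisModule W p) τ x = x) →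
        ∃ d : W.geomPrimaryTorsion p,
          (∀ τ ∈ absInertia (v.adicCompletion K), GaloisRep.toLocal v (primaryGaloisModule W p) τ d = d) ∧
            p ^ (m + e) • d = p ^ e • x := by
  -- the subgroup of inertia invariants
  let N : AddSubgroup (W.geomPrimaryTorsion p) :=
    { carrier := {x | ∀ τ ∈ absInertia (v.adicCompletion K), GaloisRep.toLocal v (primaryGaloisModule W p) τ x = x}
      add_mem' := fun {x y} hx hy τ hτ => by rw [map_add, hx τ hτ, hy τ hτ]
      zero_mem' := fun τ _ => map_zero _
      neg_mem' := fun {x} hx τ hτ => by rw [map_neg, hx τ hτ] }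
  have hmemN : ∀ x, x ∈ N ↔
      ∀ τ ∈ absInertia (v.adicCompletion K), GaloisRep.toLocal v (primaryGaloisModule W p) τ x = x := fun _ => Iff.rfl
  -- finite layers: `N[p^i] ⊆ E[p^i]`
  have hfin : ∀ i, Finite ↥(N ⊓ (nsmulAddMonoidHom (p ^ i) : W.geomPrimaryTorsion p →+ _).ker) := by
    intro i
    haveI : NeZero (p ^ i) := ⟨pow_ne_zero i (Fact.out : p.Prime).ne_zero⟩
    haveI : Finite (W.geomTorsion ((p ^ i : ℕ) : ℤ)) := finite_geomTorsion_of_neZero W (p ^ i)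
    have hsub : ((N ⊓ (nsmulAddMonoidHom (p ^ i) : W.geomPrimaryTorsion p →+ _).ker : AddSubgroup _) : Set _) ⊆
        Set.range (primaryInclusion W p i) := by
      intro x hx
      obtain ⟨P, hP⟩ := exists_primaryInclusion_eq_of_nsmul_eq_zero W p i x
        (by simpa [AddMonoidHom.mem_ker] using hx.2)
      exact ⟨P, hP⟩
    exact ((Set.finite_range _).subset hsub).to_subtype
  -- `p`-primary torsion
  have htors : ∀ x ∈ N, ∃ i, p ^ i • x = 0 := by
    intro x _
    obtain ⟨i, hi⟩ := (AddCommGroup.mem_primaryComponent).mp x.2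
    exact ⟨i, Subtype.ext (by simpa using hi)⟩
  obtain ⟨e₀, he₀⟩ := DivisibleCore.exists_pow_nsmul_eq_pow_add_nsmul N p hfin htors
  refine ⟨e₀, fun e he m x hx => ?_⟩
  obtain ⟨d, hdN, hd⟩ := he₀ x ((hmemN x).2 hx) (m + (e - e₀))
  refine ⟨p ^ (e - e₀) • d, fun τ hτ => by rw [map_nsmul, (hmemN d).1 hdN τ hτ], ?_⟩
  -- `p^{m+e} • p^{e-e₀} • d = p^{e-e₀} • p^{e₀ + m + (e-e₀)} • d = p^{e-e₀} • p^{e₀} • x = p^e • x`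
  have h1 : p ^ (m + e) • p ^ (e - e₀) • d = p ^ (e - e₀) • (p ^ (e₀ + (m + (e - e₀))) • d) := by
    rw [← mul_smul, ← mul_smul]
    congr 1
    rw [← pow_add, ← pow_add]
    congr 1
    omega
  rw [h1, hd, ← mul_smul, ← pow_add]
  congr 2
  omega

/-- **(hN) at every finite `v ∉ P`, uniformly in `e ≥ e₁`** (`P ⊆ T`, `T ⊇` the bad places and the places above `p`):
`e₁ = max_{v ∈ T∖P} e_v` over the finitely many bad places outside `P` (`exists_bound_inertiaInvariants`); the good places
need no bound (`exists_nsmul_fixed_of_good`). [cite: GreenbergLNM1716, §3 Lemma 3.3] [cite: SilvermanAEC2009, Prop. VII.4.1(a)] -/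
theorem exists_forall_hN (P T : Finset (HeightOneSpectrum (𝓞 K)))
    (hT : ∀ v : HeightOneSpectrum (𝓞 K), v ∉ T → (p : 𝓞 K) ∉ v.asIdeal ∧ W.HasGoodReductionAt v) :
    ∃ e₁ : ℕ, ∀ e, e₁ ≤ e → ∀ (m : ℕ) (v : HeightOneSpectrum (𝓞 K)), v ∉ P → ∀ x : W.geomPrimaryTorsion p,
      (∀ τ ∈ absInertia (v.adicCompletion K), GaloisRep.toLocal v (primaryGaloisModule W p) τ x = x) →
        ∃ d : W.geomPrimaryTorsion p,
          (∀ τ ∈ absInertia (v.adicCompletion K), GaloisRep.toLocal v (primaryGaloisModule W p) τ d = d) ∧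
            p ^ (m + e) • d = p ^ e • x := by
  choose e₀ he₀ using fun v : HeightOneSpectrum (𝓞 K) => exists_bound_inertiaInvariants W p v
  refine ⟨T.sup e₀, fun e he m v hvP x hx => ?_⟩
  by_cases hvT : v ∈ T
  · exact he₀ v e ((Finset.le_sup hvT).trans he) m x hx
  · exact exists_nsmul_fixed_of_good W p (hT v hvT).1 (hT v hvT).2 m e x

/-- **The exact count for all large levels.**  For finite sets `P ⊆ T` of finite places (`T ⊇` the bad places and the places
above `p`) there is `e₁` such that for every `e ≥ e₁`, every `m`, every Poitou–Tate family `inv` at level `p^{m+e}`, Kato's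
structures `𝓢 ≤ ℛ` on `E[p^{m+e}]` and `𝓢∞` on `E[p^∞]` (zero / everything at `P`, UNRAMIFIED at every finite `v ∉ P`), if
`Sel_str^{ur}(K,E[p^∞]) = H¹_{𝓢∞}` is finite and killed by `p^m`, and `p^e` kills `E(K_v)[p^∞]` for `v ∈ P ∋ v₀`, then
**`#H¹_ℛ(K, E[p^{m+e}]) = #Sel_str^{ur}(K, E[p^∞]) · ∏_{v∈P} #𝓚_v`**.  Over `ℚ` with `P = {p}`: `#H¹(ℤ[1/p], E[p^k]) =
#Sel_str^{ur}(ℚ,E[p^∞]) · #E(ℚ_p)[p^k] · p^k` for all `k ≫ 0` — Kato's (14.9.3)/(14.16.2) count with the strict side at `p^∞`.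
[cite: Kato2004Asterisque, (14.9.3)–(14.9.4) (p. 240) and Prop. 14.16 (p. 244)] -/
theorem exists_forall_natCard_selmerGroup_relaxed_eq (hodd : p ≠ 2) (P T : Finset (HeightOneSpectrum (𝓞 K)))
    (hPT : P ⊆ T) (hT : ∀ v : HeightOneSpectrum (𝓞 K), v ∉ T → (p : 𝓞 K) ∉ v.asIdeal ∧ W.HasGoodReductionAt v)
    (hTur : ∀ (k : ℕ) (v : HeightOneSpectrum (𝓞 K)), v ∉ T →
      GaloisRep.IsUnramifiedAt v (W.torsionGaloisModule ((p ^ k : ℕ) : ℤ)))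
    (hP : ∀ (k : ℕ) (v : HeightOneSpectrum (𝓞 K)), 1 ≤ k → ((p ^ k : ℕ) : 𝓞 K) ∈ v.asIdeal → v ∈ P)
    (𝓢inf : SelmerStructure (primaryGaloisModule W p)) [Finite 𝓢inf.selmerGroup]
    (hIP : ∀ v ∈ P, 𝓢inf (Sum.inr v) = ⊥)
    (hIur : ∀ v ∉ P, 𝓢inf (Sum.inr v) = unramifiedSubgroup (GaloisRep.toLocal v (primaryGaloisModule W p)) 1)
    (hIinl : ∀ w : InfinitePlace K, 𝓢inf (Sum.inl w) = ⊤) {v₀ : HeightOneSpectrum (𝓞 K)} (hv₀P : v₀ ∈ P) :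
    ∃ e₁ : ℕ, ∀ e, e₁ ≤ e → ∀ m : ℕ, 1 ≤ m + e →
      (∀ c ∈ 𝓢inf.selmerGroup, p ^ m • c = 0) →
      (∀ v ∈ P, ∀ x : W.geomPrimaryTorsion p,
        (∀ σ : absoluteGaloisGroup (v.adicCompletion K), GaloisRep.toLocal v (primaryGaloisModule W p) σ x = x) →
          p ^ e • x = 0) →
      ∀ (inv : LocalInvariants K (p ^ (m + e))), inv.IsPerfect → inv.SumLocalTermEqZero → inv.SelmerComplement →
      ∀ (𝓢 ℛ : SelmerStructure (W.torsionGaloisModule ((p ^ (m + e) : ℕ) : ℤ))),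
        (∀ v ∈ P, 𝓢 (Sum.inr v) = ⊥) → (∀ v ∈ P, ℛ (Sum.inr v) = ⊤) →
        (∀ v ∉ P, 𝓢 (Sum.inr v) =
          unramifiedSubgroup (GaloisRep.toLocal v (W.torsionGaloisModule ((p ^ (m + e) : ℕ) : ℤ))) 1) →
        (∀ v ∉ P, ℛ (Sum.inr v) =
          unramifiedSubgroup (GaloisRep.toLocal v (W.torsionGaloisModule ((p ^ (m + e) : ℕ) : ℤ))) 1) →
        Nat.card ℛ.selmerGroup =
          Nat.card 𝓢inf.selmerGroup *
            ∏ v ∈ P, Nat.card (W.kummerSelmerStructure ((p ^ (m + e) : ℕ) : ℤ) (Sum.inr v)) := by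
  obtain ⟨e₁, he₁⟩ := exists_forall_hN W p P T hT
  refine ⟨e₁, fun e he m hme hm heP inv hperf hsum hcompl 𝓢 ℛ h𝓢P hℛP h𝓢ur hℛur => ?_⟩
  exact natCard_selmerGroup_relaxed_eq_of_primary W p m e P 𝓢 𝓢inf hodd hme inv hperf hsum hcompl T hPT
    (fun v hv => hP (m + e) v hme hv) (hTur (m + e)) ℛ h𝓢P hℛP h𝓢ur hℛur hIP hIur hIinl hm heP
    (fun v hv x hx => he₁ e he m v hv x hx) hv₀P

end Bounds

end Summit.BirchSwinnertonDyer.BirchSwinnertonDyer.Theorems.KatoFiniteLevelCount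

end
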